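import Summits.QuantumFields.YangMills.Theorems.LuscherReductionTwistedTraceScalingVacuumFloor
import Summits.QuantumFields.YangMills.Theorems.LuscherReductionTwistedTraceScalingStiffTrialPhys
import Summits.QuantumFields.YangMills.Theorems.LuscherReductionTwistedTraceScalingFloorSoftModes
import Summits.QuantumFields.YangMills.Theorems.LuscherReductionTwistedTraceScalingStepLowerModel
import Summits.QuantumFields.YangMills.Theorems.LuscherReductionTwistedTraceScalingCombTransport
import Summits.QuantumFields.YangMills.Theorems.LuscherReductionRunningReductionOrbitDist
import HarnessLib

/-!
# The VACUUM TUBE of the k = 0 FLOOR: the toron distance `d_tor`, the slow cut-off `G = e^{−γ d_tor²}`, the physical trial state `ψ = H·G`, and the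
# geometry of a near-vacuum step (lane A of S-BASE, crux `TwistedTraceScaling` stmt-QuantumFields-20203; design note
# `pub/ym-fleet/ym-luscher-20007-p1/COARSE-DESIGN.md` §18)

The floor's trial state is `ψ = H·G` with `H = stiffTrial (riccatiWeight (β/2) β μ)` (lane B's covariant Riccati Gaussian, kinetic constant `b = β` to be EXACTLY
Riccati against the lower model `e^{−β‖x‖²}` of `…StepLowerModel`) and a SLOW cut-off `G(U) = exp(−γ·d_tor(U)²)` in the distance
`d_tor U = min_{z : Fin 3 → Bool} orbitDist (twist3 z U)` to the nearest of the eight toron orbits (`…RunningReductionOrbitDist`).  This file: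
* §1 `torDist` — `≤` each twisted orbit distance, attained, `≥ 0`, link-Lipschitz with constant `1` (`abs_torDist_sub_le`), gauge AND twist invariant, measurable;
* §2 `floorCutoff γ` — values in `(0,1]`, invariant, measurable; ★ `floorCutoff_step_ge`: `G(V) ≥ G(U)·e^{−γ(2 d_tor(U) δ + δ²)}` when `Σ_e ‖V_e − U_e‖_F ≤ δ`;
  `floorCutoff_le_exp`: `G(U) ≤ e^{−γ s²}` off `{d_tor ≤ s}`;
* §3 `floorTrial β μ γ = H·G` — `0 < ψ ≤ 1`, ★ `isPhys_floorTrial` (physical: bounded measurable, gauge and twist invariant);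
* §4 the near-vacuum step `W` (links in the upper hemisphere with vector parts `≤ τ`): `exists_near_of_orbitDist_le` (a configuration at orbit distance `≤ τ ≤ 2`
  has such a gauge representative), `norm_linkVec_le` (`‖w‖ ≤ τ√n`, `w = linkVec W`), `norm_covCurl_sub_vacuum_le` (`‖D_W x − D_1̄ x‖ ≤ 504τ√N‖x‖`),
  ★ `norm_plaqCurv_sub_covCurl_linkVec_le` (`F(W) = D_W w + r`, `‖r‖ ≤ 288τ²√N + 504τ√N·τ√n`), `wilsonAction_near_vacuum_le` (`S(W) ≤ (10τ√N)² + N_P(29376τ³+700569τ⁴)`),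
  ★ `wilsonAction_sub_norm_plaqCurv_sq_le` (`S(W) − ‖F(W)‖² ≤ N_P·(837τ²)²`), `zpeSum_near_vacuum_le` (`zpeSum κ W ≤ 6Z₀(κ) + n√(κ/2)·504τ√N`);
* §5 `sum_fd_chartStep_le` — a chart step of radius `ρ` moves the links by `Σ_e ‖(P(y)·U)_e − U_e‖_F ≤ |E|·√2·ρ`.
HONEST FRAMING: fixed-lattice bookkeeping for a stub lane of a child of the CONDITIONAL reduction route (femto rung R2b1); not infinite volume, not a gap, not Clay.

## References
* M. Lüscher, Nucl. Phys. B219 (1983) 233, §3. [Luscher1983]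
* G. 't Hooft, Nucl. Phys. B153 (1979) 141. [tHooft1979]
-/

set_option autoImplicit false

noncomputable section

open MeasureTheory Real Finset
open scoped BigOperators RealInnerProductSpace Matrix.Norms.Frobenius
open Literature.MathematicalPhysics.QuantumFieldTheory
open Literature.MathematicalPhysics.QuantumLattice
open Literature.MathematicalPhysics.QuantumFieldTheory.Balaban1983to89.T4CubeChartGnomonic (gnoPoint)

namespace Summit.QuantumFields.YangMills.Theorems.FemtoTransferGap

open TwoLattice TwoLattice.Toron TwoLattice.Cov TwoLattice.Stiff TwoLattice.Harm TwoLattice.GnChart TwoLattice.Flat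

variable {L : ℕ} [NeZero L]

/-! ## §1 The distance to the nearest toron orbit -/

/-- **Toron distance**: `d_tor U = min over the eight composite centre twists z of orbitDist (twist3 z U)` — the `ℓ¹`-Frobenius distance of `U` to the
nearest of the eight gauge orbits of twisted vacua. [cite: Luscher1983, §2] [cite: tHooft1979] -/
def torDist (U : GaugeConfig 3 L SU2) : ℝ :=
  Finset.univ.inf' Finset.univ_nonempty fun z : Fin 3 → Bool => orbitDist (TT.twist3 z U)

/-- `d_tor U ≤ orbitDist (twist3 z U)` for every `z`. [folklore] -/
theorem torDist_le (z : Fin 3 → Bool) (U : GaugeConfig 3 L SU2) : torDist U ≤ orbitDist (TT.twist3 z U) :=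
  Finset.inf'_le _ (Finset.mem_univ z)

/-- In particular `d_tor U ≤ orbitDist U`. [folklore] -/
theorem torDist_le_orbitDist (U : GaugeConfig 3 L SU2) : torDist U ≤ orbitDist U := by
  have h := torDist_le (fun _ => false) U
  rwa [TT.twist3_false] at h

/-- The minimum is attained. [folklore] -/
theorem exists_torDist_eq (U : GaugeConfig 3 L SU2) : ∃ z : Fin 3 → Bool, torDist U = orbitDist (TT.twist3 z U) := by
  obtain ⟨z, -, hz⟩ := Finset.exists_mem_eq_inf' Finset.univ_nonempty (fun z : Fin 3 → Bool => orbitDist (TT.twist3 z U))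
  exact ⟨z, hz⟩

/-- `0 ≤ d_tor U`. [folklore] -/
theorem torDist_nonneg (U : GaugeConfig 3 L SU2) : 0 ≤ torDist U := by
  obtain ⟨z, hz⟩ := exists_torDist_eq U
  rw [hz]; exact orbitDist_nonneg _

/-- **Link-Lipschitz with constant 1**: `|d_tor U − d_tor V| ≤ Σ_e ‖U_e − V_e‖_F`. [folklore] -/
theorem abs_torDist_sub_le (U V : GaugeConfig 3 L SU2) : |torDist U - torDist V| ≤ ∑ e : Edge 3 L, fd (U e) (V e) := by
  have key : ∀ U V : GaugeConfig 3 L SU2, torDist U ≤ torDist V + ∑ e : Edge 3 L, fd (U e) (V e) := by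
    intro U V
    obtain ⟨z, hz⟩ := exists_torDist_eq V
    have h1 : |orbitDist (TT.twist3 z U) - orbitDist (TT.twist3 z V)| ≤ ∑ e : Edge 3 L, fd (U e) (V e) := by
      simpa only [fd] using abs_orbitDist_twist3_sub_le z U V
    have h2 : orbitDist (TT.twist3 z U) ≤ orbitDist (TT.twist3 z V) + ∑ e : Edge 3 L, fd (U e) (V e) := by
      linarith [(abs_le.mp h1).2]
    rw [hz]
    exact (torDist_le z U).trans h2
  have hsym : ∑ e : Edge 3 L, fd (V e) (U e) = ∑ e : Edge 3 L, fd (U e) (V e) := Finset.sum_congr rfl fun e _ => fd_comm _ _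
  rw [abs_le]
  constructor
  · have := key V U; rw [hsym] at this; linarith
  · linarith [key U V]

/-- **Gauge invariance** of the toron distance. [folklore] -/
theorem torDist_gaugeTransform (h : Site 3 L → SU2) (U : GaugeConfig 3 L SU2) : torDist (gaugeTransform h U) = torDist U := by
  simp only [torDist, orbitDist_twist3_gaugeTransform]

/-- **Twist invariance**: a composite twist permutes the eight twisted orbit distances. [cite: tHooft1979] -/
theorem torDist_twist3 (w : Fin 3 → Bool) (U : GaugeConfig 3 L SU2) : torDist (TT.twist3 w U) = torDist U := by
  have key : ∀ (w : Fin 3 → Bool) (U : GaugeConfig 3 L SU2), torDist (TT.twist3 w U) ≤ torDist U := by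
    intro w U
    refine Finset.le_inf' _ _ fun z _ => ?_
    have h := torDist_le (fun k => Bool.xor (z k) (w k)) (TT.twist3 w U)
    rw [TT.twist3_twist3] at h
    have hzw : (fun k => Bool.xor (Bool.xor (z k) (w k)) (w k)) = z := by funext k; simp
    rwa [hzw] at h
  refine le_antisymm (key w U) ?_
  have h := key w (TT.twist3 w U)
  rwa [TT.twist3_twist3_self] at h

/-- Twist invariance for every central `c`. [cite: tHooft1979] -/
theorem torDist_twist (k : Fin 3) {c : SU2} (hc : c ∈ Subgroup.center SU2) (U : GaugeConfig 3 L SU2) :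
    torDist (twist k c U) = torDist U := by
  obtain ⟨b, rfl⟩ := TT.exists_eq_centreElem_of_mem_center hc
  rw [TT.twist_centreElem_eq_twist3, torDist_twist3]

/-- The toron distance is measurable (a finite infimum of measurable functions). [folklore] -/
theorem measurable_torDist : Measurable (torDist (L := L)) := by
  have h : (torDist (L := L)) =
      Finset.univ.inf' Finset.univ_nonempty (fun z : Fin 3 → Bool => fun U : GaugeConfig 3 L SU2 => orbitDist (TT.twist3 z U)) := by
    funext U; rw [Finset.inf'_apply]; rfl
  rw [h]
  exact Finset.inf'_induction _ _ (fun f hf g hg => hf.inf hg) (fun z _ => measurable_orbitDist_twist3 z)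

/-! ## §2 The slow cut-off `G = e^{−γ d_tor²}` -/

/-- **The slow cut-off** `G_γ(U) = exp(−γ·d_tor(U)²)`. [cite: Luscher1983, §3] -/
def floorCutoff (γ : ℝ) (U : GaugeConfig 3 L SU2) : ℝ := Real.exp (-(γ * torDist U ^ 2))

/-- `G > 0`. [folklore] -/
theorem floorCutoff_pos (γ : ℝ) (U : GaugeConfig 3 L SU2) : 0 < floorCutoff γ U := Real.exp_pos _

/-- `G ≤ 1` (`γ ≥ 0`). [folklore] -/
theorem floorCutoff_le_one {γ : ℝ} (hγ : 0 ≤ γ) (U : GaugeConfig 3 L SU2) : floorCutoff γ U ≤ 1 := by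
  unfold floorCutoff
  rw [Real.exp_le_one_iff, neg_nonpos]; positivity

/-- Gauge invariance of `G`. [folklore] -/
theorem floorCutoff_gaugeTransform (γ : ℝ) (h : Site 3 L → SU2) (U : GaugeConfig 3 L SU2) :
    floorCutoff γ (gaugeTransform h U) = floorCutoff γ U := by
  unfold floorCutoff; rw [torDist_gaugeTransform]

/-- Twist invariance of `G`. [cite: tHooft1979] -/
theorem floorCutoff_twist3 (γ : ℝ) (w : Fin 3 → Bool) (U : GaugeConfig 3 L SU2) : floorCutoff γ (TT.twist3 w U) = floorCutoff γ U := by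
  unfold floorCutoff; rw [torDist_twist3]

/-- Twist invariance of `G` (central form). [cite: tHooft1979] -/
theorem floorCutoff_twist (γ : ℝ) (k : Fin 3) {c : SU2} (hc : c ∈ Subgroup.center SU2) (U : GaugeConfig 3 L SU2) :
    floorCutoff γ (twist k c U) = floorCutoff γ U := by
  unfold floorCutoff; rw [torDist_twist k hc]

/-- `G` is measurable. [folklore] -/
theorem measurable_floorCutoff (γ : ℝ) : Measurable (floorCutoff (L := L) γ) := by
  unfold floorCutoff
  exact Real.measurable_exp.comp ((measurable_const.mul (measurable_torDist.pow_const 2)).neg)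

/-- ★ **The cut-off along a short move**: if `Σ_e ‖V_e − U_e‖_F ≤ δ` then `G(U)·e^{−γ(2·d_tor(U)·δ + δ²)} ≤ G(V)` (`γ ≥ 0`; `d_tor V ≤ d_tor U + δ`).
[cite: Luscher1983, §3] -/
theorem floorCutoff_step_ge {γ δ : ℝ} (hγ : 0 ≤ γ) (U V : GaugeConfig 3 L SU2) (hUV : ∑ e : Edge 3 L, fd (V e) (U e) ≤ δ) :
    floorCutoff γ U * Real.exp (-(γ * (2 * torDist U * δ + δ ^ 2))) ≤ floorCutoff γ V := by
  unfold floorCutoff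
  rw [← Real.exp_add, Real.exp_le_exp]
  have h1 : torDist V ≤ torDist U + δ := by
    have := (abs_le.mp (abs_torDist_sub_le V U)).2
    linarith
  have h0 : 0 ≤ torDist V := torDist_nonneg V
  have h2 : torDist V ^ 2 ≤ (torDist U + δ) ^ 2 := pow_le_pow_left₀ h0 h1 2
  nlinarith

/-- Off the tube `{d_tor ≤ s}` the cut-off is at most `e^{−γ s²}` (`γ, s ≥ 0`). [folklore] -/
theorem floorCutoff_le_exp {γ s : ℝ} (hγ : 0 ≤ γ) (hs : 0 ≤ s) (U : GaugeConfig 3 L SU2) (hU : s ≤ torDist U) :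
    floorCutoff γ U ≤ Real.exp (-(γ * s ^ 2)) := by
  unfold floorCutoff
  rw [Real.exp_le_exp, neg_le_neg_iff]
  exact mul_le_mul_of_nonneg_left (pow_le_pow_left₀ hs hU 2) hγ

/-! ## §3 The trial state `ψ = H·G` -/

/-- **The floor's trial state** `ψ = H·G`, `H = stiffTrial (riccatiWeight (β/2) β μ)`, `G = floorCutoff γ`. [cite: Luscher1983, §3] -/
def floorTrial (β μ γ : ℝ) (U : GaugeConfig 3 L SU2) : ℝ := stiffTrial (riccatiWeight (β / 2) β μ) U * floorCutoff γ U

/-- `ψ > 0`. [folklore] -/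
theorem floorTrial_pos (β μ γ : ℝ) (U : GaugeConfig 3 L SU2) : 0 < floorTrial β μ γ U :=
  mul_pos (stiffTrial_pos _ U) (floorCutoff_pos γ U)

/-- `ψ ≤ 1` (`μ > 0`, `γ ≥ 0`). [folklore] -/
theorem floorTrial_le_one {β μ γ : ℝ} (hμ : 0 < μ) (hγ : 0 ≤ γ) (U : GaugeConfig 3 L SU2) : floorTrial β μ γ U ≤ 1 := by
  unfold floorTrial
  calc stiffTrial (riccatiWeight (β / 2) β μ) U * floorCutoff γ U ≤ 1 * 1 :=
        mul_le_mul (stiffTrial_le_one (fun s => riccatiWeight_nonneg hμ s) U) (floorCutoff_le_one hγ U) (floorCutoff_pos γ U).le zero_le_one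
    _ = 1 := mul_one _

/-- ★ **The floor's trial state is physical** (bounded measurable, gauge and twist invariant). [cite: Luscher1983, §3] [cite: tHooft1979] -/
theorem isPhys_floorTrial (β : ℝ) {μ γ : ℝ} (hμ : 0 < μ) (hγ : 0 ≤ γ) : IsPhys (floorTrial (L := L) β μ γ) := by
  have h : IsPhys (fun U : GaugeConfig 3 L SU2 => floorCutoff γ U * stiffTrial (riccatiWeight (β / 2) β μ) U) :=
    IsPhys.mul_of_invariant (isPhys_stiffTrial_riccati (β / 2) β hμ) (measurable_floorCutoff γ) (CJ := 1)
      (fun U => by rw [abs_of_pos (floorCutoff_pos γ U)]; exact floorCutoff_le_one hγ U)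
      (fun g U => floorCutoff_gaugeTransform γ g U) (fun k c hc U => floorCutoff_twist γ k hc U)
  have heq : floorTrial (L := L) β μ γ = fun U => floorCutoff γ U * stiffTrial (riccatiWeight (β / 2) β μ) U := by
    funext U; unfold floorTrial; ring
  rw [heq]; exact h

/-- `ψ` is measurable. [folklore] -/
theorem measurable_floorTrial (β : ℝ) {μ γ : ℝ} (hμ : 0 < μ) (hγ : 0 ≤ γ) : Measurable (floorTrial (L := L) β μ γ) :=
  (isPhys_floorTrial β hμ hγ).measurable

/-! ## §4 The geometry of a near-vacuum step -/

/-- ★ **From the orbit distance to a near step**: if `orbitDist U ≤ τ ≤ 2` then some gauge transform of `U` has every link in the upper hemisphere with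
vector-part components `≤ τ` (indeed `Σ_e ‖(U^g)_e − 1‖_F ≤ τ`, `|u|² ≤ ‖U − 1‖_F²/2`, `u₀ = 1 − ‖U − 1‖_F²/4`). [folklore] -/
theorem exists_near_of_orbitDist_le (U : GaugeConfig 3 L SU2) {τ : ℝ} (hU : orbitDist U ≤ τ) (hτ : τ ≤ 2) :
    ∃ g : Site 3 L → SU2, (∀ e, 0 ≤ scalarPart (gaugeTransform g U e)) ∧ ∀ (e : Edge 3 L) (c : Fin 3), |vecPart (gaugeTransform g U e) c| ≤ τ := by
  obtain ⟨g, hg⟩ := exists_orbitDist_eq U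
  have hτ0 : 0 ≤ τ := (orbitDist_nonneg U).trans hU
  set V : GaugeConfig 3 L SU2 := gaugeTransform g U with hV
  have hsum : ∑ e : Edge 3 L, fd (V e) 1 ≤ τ := by
    have h1 : gaugeDist g U ≤ τ := by rw [hg]; exact hU
    simpa only [gaugeDist, ← fd_one] using h1
  have hlink : ∀ e, fd (V e) 1 ≤ τ := fun e =>
    (Finset.single_le_sum (fun e' _ => show (0 : ℝ) ≤ fd (V e') 1 from by unfold fd; exact frobNorm_nonneg _) (Finset.mem_univ e)).trans hsum
  refine ⟨g, fun e => ?_, fun e c => ?_⟩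
  · rw [scalarPart_nonneg_iff, ← fd_one]
    have h1 := hlink e
    have h0 : 0 ≤ fd (V e) 1 := by unfold fd; exact frobNorm_nonneg _
    nlinarith
  · have h1 := hlink e
    have h0 : 0 ≤ fd (V e) 1 := by unfold fd; exact frobNorm_nonneg _
    have h2 := sum_vecPart_sq_le_frobNorm_sub_one_sq (V e)
    rw [← fd_one] at h2
    have h3 : vecPart (V e) c ^ 2 ≤ ∑ a, vecPart (V e) a ^ 2 :=
      Finset.single_le_sum (fun a _ => sq_nonneg _) (Finset.mem_univ c)
    have h4 : vecPart (V e) c ^ 2 ≤ τ ^ 2 := by nlinarith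
    exact abs_le.mpr (abs_le_of_sq_le_sq' h4 hτ0)

section NearStep

variable {W : GaugeConfig 3 L SU2} {τ : ℝ}

/-- `‖linkVec W‖ ≤ τ·√n` when every component is `≤ τ` (`n = 3|E|`). [folklore] -/
theorem norm_linkVec_le (hw : ∀ (e : Edge 3 L) (c : Fin 3), |vecPart (W e) c| ≤ τ) :
    ‖linkVec L W‖ ≤ τ * Real.sqrt (Fintype.card (Edge 3 L × Fin 3)) := by
  have hτ0 : 0 ≤ τ := (abs_nonneg _).trans (hw default 0)
  have hsq : ‖linkVec L W‖ ^ 2 ≤ (τ * Real.sqrt (Fintype.card (Edge 3 L × Fin 3))) ^ 2 := by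
    rw [EuclideanSpace.norm_sq_eq, mul_pow, Real.sq_sqrt (Nat.cast_nonneg _)]
    calc ∑ i, ‖linkVec L W i‖ ^ 2 ≤ ∑ _i : Edge 3 L × Fin 3, τ ^ 2 := Finset.sum_le_sum fun i _ => by
            rw [Real.norm_eq_abs, sq_abs, linkVec_apply]
            exact sq_le_sq' (abs_le.mp (hw i.1 i.2)).1 (abs_le.mp (hw i.1 i.2)).2
      _ = τ ^ 2 * Fintype.card (Edge 3 L × Fin 3) := by simp [mul_comm]
  exact (pow_le_pow_iff_left₀ (norm_nonneg _) (by positivity) two_ne_zero).mp hsq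

/-- `‖D_W x − D_1̄ x‖ ≤ 504τ√N·‖x‖` for a near step (`τ ≤ 1`). [cite: Luscher1983, §3] -/
theorem norm_covCurl_sub_vacuum_le (hτ1 : τ ≤ 1) (hw : ∀ (e : Edge 3 L) (c : Fin 3), |vecPart (W e) c| ≤ τ) (x : LinkSpace L) :
    ‖covCurl W x - covCurl (1 : GaugeConfig 3 L SU2) x‖ ≤ 504 * τ * Real.sqrt (Fintype.card (Plaquette 3 L × Fin 3)) * ‖x‖ := by
  have h := norm_covCurl_step_sub_le (W := W) (1 : GaugeConfig 3 L SU2) hτ1 hw x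
  rwa [mul_one] at h

/-- ★ **The curvature of a near-vacuum step is in the range of its own covariant curl up to second order**:
`‖F(W) − D_W(linkVec W)‖ ≤ 288τ²√N + 504τ√N·(τ√n)` (`τ ≤ 1/30`, upper hemisphere). [cite: Luscher1983, §3] -/
theorem norm_plaqCurv_sub_covCurl_linkVec_le (hτ : τ ≤ 1 / 30) (hs : ∀ e : Edge 3 L, 0 ≤ scalarPart (W e))
    (hw : ∀ (e : Edge 3 L) (c : Fin 3), |vecPart (W e) c| ≤ τ) :
    ‖plaqCurv W - covCurl W (linkVec L W)‖ ≤
      288 * τ ^ 2 * Real.sqrt (Fintype.card (Plaquette 3 L × Fin 3)) +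
        504 * τ * Real.sqrt (Fintype.card (Plaquette 3 L × Fin 3)) * (τ * Real.sqrt (Fintype.card (Edge 3 L × Fin 3))) := by
  have hτ0 : 0 ≤ τ := (abs_nonneg _).trans (hw default 0)
  -- `‖F(W) − D_1̄ w‖ ≤ 288τ²√N`
  have h1 : ‖plaqCurv W - covCurl (1 : GaugeConfig 3 L SU2) (linkVec L W)‖ ≤ 288 * τ ^ 2 * Real.sqrt (Fintype.card (Plaquette 3 L × Fin 3)) := by
    refine norm_le_sqrt_card_mul (by positivity) fun i => ?_
    obtain ⟨p, c⟩ := i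
    have hb := (transportStep_bounds W 1 hτ hs hw p).1 c
    rw [transportStep_one] at hb
    rw [PiLp.sub_apply, plaqCurv_apply]
    exact hb
  -- `‖(D_1̄ − D_W) w‖ ≤ 504τ√N‖w‖`
  have h2 := norm_covCurl_sub_vacuum_le (by linarith) hw (linkVec L W)
  have h3 := norm_linkVec_le hw
  have hsplit : plaqCurv W - covCurl W (linkVec L W) =
      (plaqCurv W - covCurl (1 : GaugeConfig 3 L SU2) (linkVec L W)) - (covCurl W (linkVec L W) - covCurl (1 : GaugeConfig 3 L SU2) (linkVec L W)) := by
    abel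
  rw [hsplit]
  refine (norm_sub_le _ _).trans (add_le_add h1 (h2.trans ?_))
  exact mul_le_mul_of_nonneg_left h3 (by positivity)

/-- `S(W) ≤ (10τ√N)² + N_P(29376τ³ + 700569τ⁴)` for a near-vacuum step (`τ ≤ 1/30`). [cite: Luscher1983, §3] -/
theorem wilsonAction_near_vacuum_le (hτ : τ ≤ 1 / 30) (hs : ∀ e : Edge 3 L, 0 ≤ scalarPart (W e))
    (hw : ∀ (e : Edge 3 L) (c : Fin 3), |vecPart (W e) c| ≤ τ) :
    wilsonAction su2Rep W ≤ (10 * τ * Real.sqrt (Fintype.card (Plaquette 3 L × Fin 3))) ^ 2 +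
      (Fintype.card (Plaquette 3 L) : ℝ) * (29376 * τ ^ 3 + 700569 * τ ^ 4) := by
  have hτ0 : 0 ≤ τ := (abs_nonneg _).trans (hw default 0)
  have h1 := abs_wilsonAction_flatStep_sub_le W 1 (by rw [← abelianCfg_zero_eq_one L]; exact wilsonAction_abelianCfg (L := L) 0) hτ hs hw
  rw [mul_one] at h1
  have h2 : ‖covCurl (1 : GaugeConfig 3 L SU2) (linkVec L W)‖ ≤ 10 * τ * Real.sqrt (Fintype.card (Plaquette 3 L × Fin 3)) :=
    norm_covCurl_le 1 hτ0 fun e b => by rw [linkVec_apply]; exact hw e b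
  have h3 : ‖covCurl (1 : GaugeConfig 3 L SU2) (linkVec L W)‖ ^ 2 ≤ (10 * τ * Real.sqrt (Fintype.card (Plaquette 3 L × Fin 3))) ^ 2 :=
    pow_le_pow_left₀ (norm_nonneg _) h2 2
  linarith [(abs_le.mp h1).2]

/-- ★ `S(W) − ‖F(W)‖² ≤ N_P·(837τ²)²` for a near-vacuum step: `S_p = |F_p|² + (1 − u₀(hol_p))²` exactly and `0 ≤ 1 − u₀(hol_p W) ≤ 837τ²`. [cite: Luscher1983, §3] -/
theorem wilsonAction_sub_norm_plaqCurv_sq_le (hτ : τ ≤ 1 / 30) (hs : ∀ e : Edge 3 L, 0 ≤ scalarPart (W e))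
    (hw : ∀ (e : Edge 3 L) (c : Fin 3), |vecPart (W e) c| ≤ τ) :
    wilsonAction su2Rep W - ‖plaqCurv W‖ ^ 2 ≤ (Fintype.card (Plaquette 3 L) : ℝ) * (837 * τ ^ 2) ^ 2 := by
  rw [wilsonAction_eq_sum_scalarPart, norm_plaqCurv_sq, ← Finset.sum_sub_distrib]
  have hp : ∀ p : Plaquette 3 L, 2 * (1 - scalarPart (hol W p)) - ∑ a, vecPart (hol W p) a ^ 2 ≤ (837 * τ ^ 2) ^ 2 := by
    intro p
    rw [two_mul_one_sub_scalarPart_eq, add_sub_cancel_left]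
    obtain ⟨-, -, h0, h1⟩ := transportStep_bounds W 1 hτ hs hw p
    rw [transportStep_one] at h0 h1
    have h0' : 0 ≤ 1 - scalarPart (hol W p) := by
      have := abs_scalarPart_le (hol W p); rw [abs_le] at this; linarith [this.2]
    exact pow_le_pow_left₀ h0' h1 2
  calc ∑ p : Plaquette 3 L, (2 * (1 - scalarPart (hol W p)) - ∑ a, vecPart (hol W p) a ^ 2)
      ≤ ∑ _p : Plaquette 3 L, (837 * τ ^ 2) ^ 2 := Finset.sum_le_sum fun p _ => hp p
    _ = (Fintype.card (Plaquette 3 L) : ℝ) * (837 * τ ^ 2) ^ 2 := by simp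

/-- `zpeSum κ W ≤ 6·toronZPE κ 0 0 + 3|E|·√(κ/2)·504τ√N` for a near step (`τ ≤ 1`, `κ ≥ 0`). [cite: Luscher1983, §3] -/
theorem zpeSum_near_vacuum_le (hτ1 : τ ≤ 1) (hw : ∀ (e : Edge 3 L) (c : Fin 3), |vecPart (W e) c| ≤ τ) {κ : ℝ} (hκ : 0 ≤ κ) :
    zpeSum L κ W ≤ 6 * toronZPE L κ 0 0 +
      (Fintype.card (Edge 3 L) * 3 : ℕ) * (Real.sqrt (κ / 2) * (504 * τ * Real.sqrt (Fintype.card (Plaquette 3 L × Fin 3)))) := by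
  have h := zpeSum_step_vacuum_le (W := W) hτ1 hw 1 hκ
  rwa [TT.gaugeTransform_one', abelianCfg_zero_eq_one L, mul_one] at h

end NearStep

/-! ## §5 A chart step moves the links by `O(ρ)` -/

/-- One link of the vacuum-pattern chart: `‖P(y)_e − 1‖_F ≤ √2·|y_e|` (`‖P − 1‖_F² = 4(1 − u₀) ≤ 2|y|²`). [folklore] -/
theorem fd_gnoPoint_one_le (y : Fin 3 → ℝ) : fd (gnoPoint y) 1 ≤ Real.sqrt 2 * Real.sqrt (∑ a, y a ^ 2) := by
  have h1 := one_sub_scalarPart_gnoPoint_le y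
  have h2 : fd (gnoPoint y) 1 ^ 2 ≤ (Real.sqrt 2 * Real.sqrt (∑ a, y a ^ 2)) ^ 2 := by
    rw [fd_one, frobNorm_sub_one_sq_eq_scalarPart, mul_pow, Real.sq_sqrt (by norm_num), Real.sq_sqrt (Finset.sum_nonneg fun a _ => sq_nonneg _)]
    linarith
  have h0 : 0 ≤ fd (gnoPoint y) 1 := by unfold fd; exact frobNorm_nonneg _
  exact (pow_le_pow_iff_left₀ h0 (by positivity) two_ne_zero).mp h2

/-- ★ **A chart step of radius `ρ` moves the links by at most `|E|·√2·ρ`** in the `ℓ¹`-Frobenius metric. [folklore] -/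
theorem sum_fd_chartStep_le (U : GaugeConfig 3 L SU2) {ρ : ℝ} (hρ : 0 ≤ ρ) (y : Edge 3 L → Fin 3 → ℝ) (hy : ∀ e, ∑ a, y e a ^ 2 ≤ ρ ^ 2) :
    ∑ e : Edge 3 L, fd ((latPatternChart L (fun _ => false) y * U) e) (U e) ≤ Fintype.card (Edge 3 L) * (Real.sqrt 2 * ρ) := by
  have hlink : ∀ e : Edge 3 L, fd ((latPatternChart L (fun _ => false) y * U) e) (U e) ≤ Real.sqrt 2 * ρ := by
    intro e
    rw [Pi.mul_apply, latPatternChart_false]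
    have h1 : fd (gnoPoint (y e) * U e) (U e) = fd (gnoPoint (y e)) 1 := by
      conv_lhs => rw [show U e = 1 * U e from (one_mul _).symm]
      rw [show gnoPoint (y e) * (1 * U e) = gnoPoint (y e) * U e from by rw [one_mul], fd_mul_right]
    rw [h1]
    refine (fd_gnoPoint_one_le (y e)).trans (mul_le_mul_of_nonneg_left ?_ (Real.sqrt_nonneg _))
    calc Real.sqrt (∑ a, y e a ^ 2) ≤ Real.sqrt (ρ ^ 2) := Real.sqrt_le_sqrt (hy e)
      _ = ρ := Real.sqrt_sq hρ
  calc ∑ e : Edge 3 L, fd ((latPatternChart L (fun _ => false) y * U) e) (U e) ≤ ∑ _e : Edge 3 L, Real.sqrt 2 * ρ :=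
        Finset.sum_le_sum fun e _ => hlink e
    _ = Fintype.card (Edge 3 L) * (Real.sqrt 2 * ρ) := by simp

end Summit.QuantumFields.YangMills.Theorems.FemtoTransferGap

end
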